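import Summits.AnomalousDissipation.AnomalousDissipation.Theorems.TaylorWaveQuasiSteady.Negative.HorizontalCalculus

/-!
# `NeutralTaylorWaves.TaylorWaveQuasiSteady` (stmt-AnomalousDissipation-16293): axis-invariant witnesses are horizontally quiet

Negative lemmas (crux disprover, 2026-08-17), sequel of `Negative/Stretching.lean` (planar witnesses are
impossible). Here the witnesses are only assumed INVARIANT along an axis `a` (`∂_a w ≡ 0`, all three
components allowed — "two-and-a-half-dimensional" fields). Write `w = w_h + w_a e_a` with the horizontal
part `w_h := w − w_a e_a` (planar w.r.t. `a`) and the axial, passively advected component `w_a`.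

(The calculus of `w_h` is in `Negative/HorizontalCalculus.lean`.)

* `horizontal_dissipation_bound` — for smooth divergence-free `w` with `∂_a w ≡ 0`, ANY smooth pressure `q`,
  force `f`, drift `c`, viscosity `ν ≥ 0` and `s ≥ 0`:
  `2s·ν‖∇w_h‖₂² ≤ ‖R‖₂² + ν‖Δf‖₂² + (ν + s²)‖w‖₂²`, where `R` is the FULL steady residual of `w` itself.
  Key pointwise identity: the planar residual `R'` of `w_h` (same `q`, `f`, `c`) differs from `R` by a
  multiple of `e_a`, while `(Δw_h)_a = 0`, so `⟪R', Δw_h⟫ = ⟪R, Δw_h⟫`; then the enstrophy balance of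
  `Stretching.lean` for `w_h`, whose stretching term vanishes (`w_h` is planar).
* `taylorWaveQuasiSteady_false_twoHalfD_quietAxial` — hence the crux restricted to axis-invariant witnesses
  whose AXIAL component carries only an `O(√ν_n)` share of the dissipation
  (`ν_n(‖∇w‖₂² − ‖∇w_h‖₂²) = ν_n‖∇w_a‖₂² ≤ C√ν_n`) is FALSE at order `K = 1`. In words: in any 2.5-D witness
  family ALL the anomalous dissipation must be carried by the passive axial scalar `w_a`, stirred by a planar
  flow whose own dissipation is `O(√ν_n)` — the 2.5-D strengthening is thereby reduced to a steady-source
  passive-scalar problem (recorded as the remaining near-miss in `Cruxes/TaylorWaveQuasiSteady/Disproof.lean`).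
-/

-- `Summit.<Summit>.<Problem>` is the tree's mandated summit-side namespace (CONVENTIONS §2); for this
-- single-conjunct summit the two coincide, so the duplicate is deliberate.
set_option linter.dupNamespace false

noncomputable section

open MeasureTheory Filter Topology
open scoped InnerProductSpace

namespace Summit.AnomalousDissipation.AnomalousDissipation.Theorems.TaylorWaveQuasiSteady.Negative

open Literature.Analysis.FunctionSpaces

/-! ## The horizontal dissipation bound -/

section Bound

variable {w f : UnitAddTorus (Fin 3) → EuclideanSpace ℝ (Fin 3)} {q : UnitAddTorus (Fin 3) → ℝ}
  {a : Fin 3}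

/-- **Horizontal dissipation bound.** For smooth divergence-free `w` with `∂_a w ≡ 0`, smooth `q`, `f`,
`ν ≥ 0`, `s ≥ 0`, any drift `c` along any axis `i`, and the FULL steady residual
`R = (w·∇)w − νΔw + ∇q − c∂ᵢw − f` of `w`:
`2s·ν‖∇w_h‖₂² ≤ ‖R‖₂² + ν‖Δf‖₂² + ν‖w‖₂² + s²‖w‖₂²`, `w_h = w − w_a e_a`. [folklore] -/
theorem horizontal_dissipation_bound (hw : Torus.IsSmooth w) (hq : Torus.IsSmooth q)
    (hf : Torus.IsSmooth f) (hdiv : Torus.IsDivFree w) (hinv : ∀ x, Torus.partialDeriv a w x = 0)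
    {ν : ℝ} (hν : 0 ≤ ν) (c : ℝ) (i : Fin 3) {s : ℝ} (hs : 0 ≤ s) :
    2 * s * (ν * Torus.gradNormSq (fun y => w y - (w y a) • EuclideanSpace.single a (1 : ℝ))) ≤
      (∫ x, ‖Torus.convect w w x - ν • Torus.laplacian w x + Torus.gradient q x
          - c • Torus.partialDeriv i w x - f x‖ ^ 2)
        + ν * (∫ x, ‖Torus.laplacian f x‖ ^ 2) + ν * (∫ x, ‖w x‖ ^ 2)
        + s ^ 2 * (∫ x, ‖w x‖ ^ 2) := by
  set e : EuclideanSpace ℝ (Fin 3) := EuclideanSpace.single a (1 : ℝ) with he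
  set wh : UnitAddTorus (Fin 3) → EuclideanSpace ℝ (Fin 3) := fun y => w y - (w y a) • e with hwh_def
  have hθ : Torus.IsSmooth (fun y => w y a) := hw.apply a
  have hwh : Torus.IsSmooth wh := isSmooth_sub_smul_const hw hθ e
  have hdivh : Torus.IsDivFree wh := isDivFree_horizontal hw hdiv hinv
  have hwha : ∀ x, wh x a = 0 := fun x => horizontal_apply_axis w a x
  have hinvh : ∀ x, Torus.partialDeriv a wh x = 0 := fun x => partialDeriv_horizontal_axis hw hinv x
  set R : UnitAddTorus (Fin 3) → EuclideanSpace ℝ (Fin 3) := fun x =>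
    Torus.convect w w x - ν • Torus.laplacian w x + Torus.gradient q x
      - c • Torus.partialDeriv i w x - f x with hR_def
  set R' : UnitAddTorus (Fin 3) → EuclideanSpace ℝ (Fin 3) := fun x =>
    Torus.convect wh wh x - ν • Torus.laplacian wh x + Torus.gradient q x
      - c • Torus.partialDeriv i wh x - f x with hR'_def
  set R₀ : UnitAddTorus (Fin 3) → EuclideanSpace ℝ (Fin 3) := fun x =>
    -(ν • Torus.laplacian wh x) + Torus.gradient q x - c • Torus.partialDeriv i wh x - f x with hR₀_def
  have hRs : Torus.IsSmooth R :=
    ((((hw.convect hw).sub (hw.laplacian.smul ν)).add hq.gradient).sub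
      ((hw.partialDeriv i).smul c)).sub hf
  have hR's : Torus.IsSmooth R' :=
    ((((hwh.convect hwh).sub (hwh.laplacian.smul ν)).add hq.gradient).sub
      ((hwh.partialDeriv i).smul c)).sub hf
  have hL := hwh.laplacian
  have hN := hwh.convect hwh
  -- (A) pointwise: `R' = R + t e` with `⟪e, Δw_h⟫ = 0`, hence `⟪R', Δw_h⟫ = ⟪R, Δw_h⟫`
  have hpair : ∀ x, ⟪R' x, Torus.laplacian wh x⟫_ℝ = ⟪R x, Torus.laplacian wh x⟫_ℝ := by
    intro x
    have hconv := convect_horizontal hw hinv x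
    have hlap := laplacian_horizontal hw a x
    have hpd := partialDeriv_horizontal hw a i x
    set t : ℝ := -(Torus.fderiv (fun y => w y a) x (wh x)) + ν * Torus.laplacian (fun y => w y a) x
      + c * Torus.partialDeriv i w x a with ht
    have hdiff : R' x = R x + t • e := by
      simp only [hR'_def, hR_def, hwh_def, ht]
      rw [hconv, hlap, hpd]
      simp only [he]
      module
    have horth : ⟪e, Torus.laplacian wh x⟫_ℝ = 0 := by
      rw [he, inner_single_one_left]
      exact laplacian_horizontal_apply_axis hw a x
    rw [hdiff, inner_add_left, real_inner_smul_left, horth, mul_zero, add_zero]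
  -- (B) the linear enstrophy identity for `w_h`, and the splitting `R₀ = R' − (w_h·∇)w_h`
  have hid : ν * ∫ x, ‖Torus.laplacian wh x‖ ^ 2 =
      -(∫ x, ⟪R₀ x, Torus.laplacian wh x⟫_ℝ) - ∫ x, ⟪Torus.laplacian f x, wh x⟫_ℝ :=
    linear_enstrophy_identity hwh hq hf hdivh ν c i
  have hsplit : ∫ x, ⟪R₀ x, Torus.laplacian wh x⟫_ℝ = ∫ x, ⟪R x, Torus.laplacian wh x⟫_ℝ := by
    have h1 : ∫ x, ⟪R₀ x, Torus.laplacian wh x⟫_ℝ =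
        (∫ x, ⟪R' x, Torus.laplacian wh x⟫_ℝ) - ∫ x, ⟪Torus.convect wh wh x, Torus.laplacian wh x⟫_ℝ := by
      rw [← integral_sub (hR's.inner hL).integrable (hN.inner hL).integrable]
      refine integral_congr_ae (ae_of_all _ fun x => ?_)
      have hx : R₀ x = R' x - Torus.convect wh wh x := by
        simp only [hR'_def, hR₀_def]
        abel
      dsimp only
      rw [hx, inner_sub_left]
    rw [h1, integral_inner_convect_laplacian_eq_zero_of_planar hwh hdivh hwha hinvh, sub_zero]
    exact integral_congr_ae (ae_of_all _ fun x => hpair x)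
  -- (C) Young: `-2ν⟪R, Δw_h⟫ ≤ ‖R‖² + ν²‖Δw_h‖²` and `-2ν⟪Δf, w_h⟫ ≤ ν(‖Δf‖² + ‖w_h‖²)`
  have hB1 : ∀ x, -(2 * ν * ⟪R x, Torus.laplacian wh x⟫_ℝ) ≤
      ‖R x‖ ^ 2 + ν ^ 2 * ‖Torus.laplacian wh x‖ ^ 2 := by
    intro x
    have h := two_mul_mul_inner_le (R x) (-Torus.laplacian wh x) hν
    rw [inner_neg_right, norm_neg] at h
    linarith
  have hB2 : ∀ x, -(2 * ν * ⟪Torus.laplacian f x, wh x⟫_ℝ) ≤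
      ν * ‖Torus.laplacian f x‖ ^ 2 + ν * ‖wh x‖ ^ 2 := by
    intro x
    have h := two_mul_mul_inner_le (Torus.laplacian f x) (-wh x) zero_le_one
    rw [inner_neg_right, norm_neg] at h
    nlinarith [h, hν]
  have iB1l : Integrable (fun x => -(2 * ν * ⟪R x, Torus.laplacian wh x⟫_ℝ)) volume :=
    (((hRs.inner hL).integrable).const_mul (2 * ν)).neg
  have iB1r : Integrable (fun x => ‖R x‖ ^ 2 + ν ^ 2 * ‖Torus.laplacian wh x‖ ^ 2) volume :=
    hRs.norm_sq.integrable.add (hL.norm_sq.integrable.const_mul _)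
  have iB2l : Integrable (fun x => -(2 * ν * ⟪Torus.laplacian f x, wh x⟫_ℝ)) volume :=
    (((hf.laplacian.inner hwh).integrable).const_mul (2 * ν)).neg
  have iB2r : Integrable (fun x => ν * ‖Torus.laplacian f x‖ ^ 2 + ν * ‖wh x‖ ^ 2) volume :=
    (hf.laplacian.norm_sq.integrable.const_mul _).add (hwh.norm_sq.integrable.const_mul _)
  have hm1 := integral_mono iB1l iB1r hB1
  have hm2 := integral_mono iB2l iB2r hB2
  rw [integral_neg, integral_const_mul,
    integral_add hRs.norm_sq.integrable (hL.norm_sq.integrable.const_mul _),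
    integral_const_mul] at hm1
  rw [integral_neg, integral_const_mul,
    integral_add (hf.laplacian.norm_sq.integrable.const_mul _) (hwh.norm_sq.integrable.const_mul _),
    integral_const_mul, integral_const_mul] at hm2
  -- hence `ν²‖Δw_h‖² ≤ ‖R‖² + ν‖Δf‖² + ν‖w_h‖²`
  have hBB : ν ^ 2 * ∫ x, ‖Torus.laplacian wh x‖ ^ 2 ≤
      (∫ x, ‖R x‖ ^ 2) + ν * (∫ x, ‖Torus.laplacian f x‖ ^ 2) + ν * (∫ x, ‖wh x‖ ^ 2) := by
    rw [hsplit] at hid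
    nlinarith [hid, hm1, hm2]
  -- (D) Young: `2s⟪-νΔw_h, w_h⟫ ≤ ν²‖Δw_h‖² + s²‖w_h‖²`, and `∫⟪-νΔw_h, w_h⟫ = ν‖∇w_h‖²`
  have hC : ∀ x, 2 * s * ⟪-(ν • Torus.laplacian wh x), wh x⟫_ℝ ≤
      ν ^ 2 * ‖Torus.laplacian wh x‖ ^ 2 + s ^ 2 * ‖wh x‖ ^ 2 := by
    intro x
    have h := two_mul_mul_inner_le (-(ν • Torus.laplacian wh x)) (wh x) hs
    rw [norm_neg, norm_smul, mul_pow, Real.norm_eq_abs, sq_abs] at h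
    exact h
  have iCl : Integrable (fun x => 2 * s * ⟪-(ν • Torus.laplacian wh x), wh x⟫_ℝ) volume :=
    (((hL.smul ν).neg.inner hwh).integrable).const_mul (2 * s)
  have iCr : Integrable (fun x => ν ^ 2 * ‖Torus.laplacian wh x‖ ^ 2 + s ^ 2 * ‖wh x‖ ^ 2) volume :=
    (hL.norm_sq.integrable.const_mul _).add (hwh.norm_sq.integrable.const_mul _)
  have hm3 := integral_mono iCl iCr hC
  rw [integral_const_mul,
    integral_add (hL.norm_sq.integrable.const_mul _) (hwh.norm_sq.integrable.const_mul _),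
    integral_const_mul, integral_const_mul] at hm3
  have eC : ∫ x, ⟪-(ν • Torus.laplacian wh x), wh x⟫_ℝ = ν * Torus.gradNormSq wh := by
    simp_rw [inner_neg_left, real_inner_smul_left]
    rw [integral_neg, integral_const_mul]
    rw [Torus.integral_inner_laplacian_self_eq_neg_gradNormSq_of_isSmooth hwh]
    ring
  rw [eC] at hm3
  -- (E) `‖w_h‖₂² ≤ ‖w‖₂²`
  have hEh : ∫ x, ‖wh x‖ ^ 2 ≤ ∫ x, ‖w x‖ ^ 2 :=
    integral_mono hwh.norm_sq.integrable hw.norm_sq.integrable fun x => norm_sq_horizontal_le w a x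
  have hEh0 : 0 ≤ ∫ x, ‖wh x‖ ^ 2 := integral_nonneg fun x => by positivity
  nlinarith [hBB, hm3, hEh, hEh0, hν, sq_nonneg s, mul_le_mul_of_nonneg_left hEh hν,
    mul_le_mul_of_nonneg_left hEh (sq_nonneg s)]

end Bound

/-! ## The negative lemma -/

/-- **All loudness of an axis-invariant witness sits in its axial passive component** [negative lemma for
`NeutralTaylorWaves.TaylorWaveQuasiSteady`, stmt-AnomalousDissipation-16293; refutes a natural 2.5-D
strengthening]: there is NO fixed-force, light, loud, quasi-steady family whose members are invariant
along some axis `a = a(K, n)` (`∂_a w ≡ 0`) and whose AXIAL component `w_a` carries only an `O(√ν_n)`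
share of the dissipation, `ν_n(‖∇w‖₂² − ‖∇w_h‖₂²) ≤ C√ν_n` (`w_h = w − w_a e_a`; the difference is
`ν_n‖∇w_a‖₂²`) — already at order `K = 1`. Proof: `horizontal_dissipation_bound` with `s = √ν_n` gives
`2ν_n‖∇w_h‖² ≤ √ν_n(C + ‖Δf‖₂² + 2E)` against `ν_n‖∇w_h‖² ≥ ε₀ − 2C√ν_n`. So in a 2.5-D witness family
the anomalous dissipation is that of the passive scalar `w_a` advected by the planar flow `w_h`, whose own
dissipation is `O(√ν_n)`. [folklore] -/
theorem taylorWaveQuasiSteady_false_twoHalfD_quietAxial :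
    ¬ ∃ f : UnitAddTorus (Fin 3) → EuclideanSpace ℝ (Fin 3),
      Torus.IsSmooth f ∧ Torus.IsDivFree f ∧ Torus.HasZeroMean f ∧
      ∃ (ν : ℕ → ℝ) (E ε₀ : ℝ), (∀ n, 0 < ν n) ∧ Filter.Tendsto ν Filter.atTop (nhds 0) ∧ 0 < ε₀ ∧
      ∀ K : ℕ, ∃ C : ℝ, ∀ n : ℕ, ∃ (w : UnitAddTorus (Fin 3) → EuclideanSpace ℝ (Fin 3))
        (q : UnitAddTorus (Fin 3) → ℝ) (c : ℝ),
        (∃ a : Fin 3, (∀ x, Torus.partialDeriv a w x = 0) ∧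
          ν n * Torus.gradNormSq w
            - ν n * Torus.gradNormSq (fun y => w y - (w y a) • EuclideanSpace.single a (1 : ℝ))
            ≤ C * Real.sqrt (ν n)) ∧
        Torus.IsSmooth w ∧ Torus.IsSmooth q ∧ Torus.IsDivFree w ∧ Torus.HasZeroMean w ∧ |c| ≤ C ∧
        MeasureTheory.integral MeasureTheory.volume (fun x => ‖w x‖ ^ 2) ≤ E ∧
        |ν n * Torus.gradNormSq w - ε₀| ≤ C * Real.sqrt (ν n) ∧
        MeasureTheory.integral MeasureTheory.volume (fun x =>
          ‖Torus.convect w w x - (ν n) • Torus.laplacian w x + Torus.gradient q x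
            - c • Torus.partialDeriv (2 : Fin 3) w x - f x‖ ^ 2) ≤ C * (ν n) ^ (K : ℕ) := by
  rintro ⟨f, hf, -, -, ν, E, ε₀, hν, hν0, hε₀, hK⟩
  obtain ⟨C, hC⟩ := hK 1
  set F₂ : ℝ := ∫ x, ‖Torus.laplacian f x‖ ^ 2
  have hF₂0 : 0 ≤ F₂ := integral_nonneg fun x => by positivity
  -- constants are nonnegative (from `n = 0`)
  obtain ⟨w₀, q₀, c₀, -, -, -, -, -, hc₀, hE₀, -, -⟩ := hC 0
  have hC0 : 0 ≤ C := (abs_nonneg c₀).trans hc₀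
  have hE0 : 0 ≤ E := (integral_nonneg fun x => by positivity).trans hE₀
  -- choose `n` with `√ν_n < δ`
  set M : ℝ := 5 * C + F₂ + 2 * E + 1 with hM
  have hMpos : 0 < M := by rw [hM]; linarith
  obtain ⟨δ, hδ, hδM⟩ : ∃ δ : ℝ, 0 < δ ∧ δ * M < 2 * ε₀ :=
    ⟨ε₀ / M, div_pos hε₀ hMpos, by rw [div_mul_cancel₀ _ hMpos.ne']; linarith⟩
  obtain ⟨n, hn⟩ : ∃ n, ν n < δ ^ 2 :=
    (hν0.eventually (gt_mem_nhds (by positivity))).exists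
  obtain ⟨w, q, c, ⟨a, hinv, hax⟩, hw, hq, hdiv, -, -, hEn, hDn, hRn⟩ := hC n
  set r : ℝ := Real.sqrt (ν n)
  have hr0 : 0 ≤ r := Real.sqrt_nonneg _
  have hrr : r ^ 2 = ν n := Real.sq_sqrt (hν n).le
  have hrδ : r < δ := (Real.sqrt_lt' hδ).2 hn
  -- the horizontal dissipation bound with `s = r`
  have hB := horizontal_dissipation_bound hw hq hf hdiv hinv (hν n).le c (2 : Fin 3) hr0
  set Gh : ℝ := Torus.gradNormSq (fun y => w y - (w y a) • EuclideanSpace.single a (1 : ℝ))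
  have hE' : 0 ≤ ∫ x, ‖w x‖ ^ 2 := integral_nonneg fun x => by positivity
  rw [pow_one] at hRn
  -- `2 r (ν G_h) ≤ r² (C + F₂ + 2E)`
  have h1 : 2 * r * (ν n * Gh) ≤ r ^ 2 * (C + F₂ + 2 * E) := by
    rw [hrr]
    nlinarith [hB, hRn, hEn, hE', (hν n).le, hF₂0, mul_le_mul_of_nonneg_left hEn (hν n).le,
      mul_le_mul_of_nonneg_left hEn (sq_nonneg r)]
  -- dissipation clauses: `ε₀ ≤ ν G + C r` and `ν G − ν G_h ≤ C r`
  have h2 : ε₀ ≤ ν n * Gh + 2 * C * r := by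
    have := (abs_le.1 hDn).1
    linarith
  have hrpos : 0 < r := Real.sqrt_pos.2 (hν n)
  have h3 : 2 * (ν n * Gh) ≤ r * (C + F₂ + 2 * E) := by
    have := h1
    nlinarith [this, hrpos]
  have h4 : 2 * ε₀ ≤ r * M := by rw [hM]; nlinarith [h2, h3, hC0, hr0]
  have h5 : r * M < 2 * ε₀ := by nlinarith [hrδ, hMpos, hr0, hδM]
  linarith

end Summit.AnomalousDissipation.AnomalousDissipation.Theorems.TaylorWaveQuasiSteady.Negative

end
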